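import Literature.NumberTheory.DiophantineGeometry.GenEllDeFamilySlopeDefectOnly
import Literature.NumberTheory.DiophantineGeometry.GenEllDeFamilyBadPrimesConverse
import Literature.NumberTheory.DiophantineGeometry.GenEllMechanismKappaRoots
import Literature.NumberTheory.DiophantineGeometry.P1FiniteMapCuspMeeting
import Literature.NumberTheory.DiophantineGeometry.GenEllDeCriticalValuesFamilyXphi
import Literature.NumberTheory.DiophantineGeometry.GenEllDeFibresPolynomial
import Literature.NumberTheory.DiophantineGeometry.SuperellipticHeightsFamilyJunction
import HarnessLib

/-!
# [GenEll] Thm. 2.1 on the `D_e` route: the conductor bound `hκ` of the noncritical-Belyi mechanism,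
# GENERIC FORM (`GenEllMechanismKappa`, all bad primes by DEFECTS — no finite-place separation consumed)

S. Mochizuki, *Arithmetic elliptic curves in general position*, Math. J. Okayama Univ. 52 (2010),
Prop. 1.6 p. 10 (reduced divisor) as used in the proof of Thm. 2.1 pp. 12–13
[cite: MochizukiGenEll2010, Prop 1.6 p.10]. Support file for the route item `GenEllTwo`
(stmt-ABC-19679); assignment «GenEllMechanismKappa» of the package owner abc-iut-S6 to the W5
coordinator abc-iut-w5-d045; classical, nothing here bears on [IUTchIII] Cor. 3.12.

This is the companion of `GenEllMechanismKappa.lean` in EXACTLY the binder shape of the hypothesis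
`hKappa` of abc-iut-w5-d075's `mechanismFor_of_kappa` (W9 assembly, piece 3): the number field `K` is
fixed BEFORE the Belyi datum `φ` (only the critical-locus polynomial `R_c` must split in `K`), there is NO
degree bound on `L`, and the `2`-adic separation binder is idle — following the package owner's option
«`S₁ := ∅`» (STATUS 2026-08-26T03:52:56Z): every bad prime INCLUDING `2` is treated by the defect
inequality (abc-iut-w5-d023's `DeC.slope_defect_of_splits` over abc-iut-w5-d090's (F-b) and
abc-iut-w5-d054's (S1)), so that only the archimedean separation is consumed by `hκ`. The cusp fibre
`B = roots(f·g·(f−g))` is read in `L` (its cardinality and heights are field-independent: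
abc-iut-w5-d023's `card_rootFinset_map_eq_of_splits`, `exists_logHeight₁_rootFinset_le`).

Conclusion, for every `φ` of the noncritical-Belyi shape and every `ρ > 0`, one constant `C₂` with

  `log-cond_{φ^*C}(t_c(x, r)) ≤ (((n + 2)(2k+4) − (6k+6))/(2k+1)) · ht(x) + C₂`

at every point `(x, r) ∈ D_e(L)` (`L ⊇ K` any number field splitting `f·g·(f−g)`) off the cusps, the
Weierstrass fibre and `φ⁻¹`-cusps, whose conjugates at `∞` are `ρ`-far from the roots of the bad
polynomial.
-/

noncomputable section

namespace Literature.NumberTheory.DiophantineGeometry.GenEll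

open _root_.Polynomial NumberField IsDedekindDomain
open Literature.IUT.LogVolume

/-! ## Small helpers -/

/-- `h(x) ≥ 0` for the Weil height of a number field element. [folklore] -/
private theorem logHeight₁_nonneg'' {L : Type*} [Field L] [NumberField L] (x : L) :
    0 ≤ Height.logHeight₁ x := by
  rw [Height.logHeight₁_eq_log_mulHeight₁]
  exact Real.log_nonneg (Height.one_le_mulHeight₁ _)

/-- An integer polynomial evaluates through a ring homomorphism: `τ (m(a)) = m(τ a)`. [folklore] -/
private theorem map_aeval_intPoly' {R S : Type*} [CommRing R] [CommRing S] (τ : R →+* S) (m : ℤ[X])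
    (a : R) : τ (aeval a m) = aeval (τ a) m := by
  rw [aeval_def, aeval_def, Polynomial.hom_eval₂]
  congr 1
  exact RingHom.ext_int _ _

/-- An integer polynomial read over `ℚ` evaluates as the integer polynomial. [folklore] -/
private theorem aeval_map_intCast' {S : Type*} [Field S] [CharZero S] (m : ℤ[X]) (y : S) :
    aeval y (m.map (Int.castRingHom ℚ)) = aeval y m := by
  rw [← algebraMap_int_eq, aeval_map_algebraMap]

/-- The roots of `m ∈ ℤ[X]` read in `R`: `a` is a root iff `m(a) = 0` (for `m ≠ 0`). [folklore] -/
private theorem mem_roots_map_intCast_iff' {R : Type*} [CommRing R] [IsDomain R] [CharZero R]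
    {m : ℤ[X]} (hm : m ≠ 0) (a : R) :
    a ∈ (m.map (Int.castRingHom R)).roots ↔ aeval a m = 0 := by
  rw [mem_roots ((Polynomial.map_ne_zero_iff (Int.castRingHom R).injective_int).mpr hm), IsRoot.def,
    eval_map, ← algebraMap_int_eq, ← aeval_def]

/-! ## The conductor bound of the mechanism, generic form -/

open scoped Classical in
/-- **`hκ` of the noncritical-Belyi mechanism, generic form** ([GenEll] Prop. 1.6, sharp form on the
cover `D_e`, summed over all places; all bad primes by defects): for `k ≥ 1`, `c ∈ ℚ^×` and a number
field `K` over which `R_c` splits, the hypothesis `hKappa` of abc-iut-w5-d075's `mechanismFor_of_kappa`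
holds verbatim. [cite: MochizukiGenEll2010, Prop 1.6 p.10] -/
theorem exists_condBound_mechanism' (k : ℕ) (hk : 1 ≤ k) {c : ℚ} (hc : c ≠ 0)
    (K : Type) [Field K] [NumberField K] (hKR : (DeCrit.RpolyC k (c : K)).Splits) :
    ∀ φ : P1FiniteMap, 0 < φ.deg → φ.num.natDegree = φ.deg → φ.den.natDegree = φ.deg →
      (φ.num - φ.den).natDegree = φ.deg →
      IsCoprime (φ.num.map (Int.castRingHom ℚ)) (φ.den.map (Int.castRingHom ℚ)) →
      (∀ a ∈ DeCrit.critSetC k c, aeval a (φ.num * φ.den * (φ.num - φ.den)) = 0) →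
      ((φ.num * φ.den * (φ.num - φ.den)).map (Int.castRingHom ℂ)).roots.toFinset.card
        = φ.deg + 2 →
      ∀ ρ : ℝ, 0 < ρ → ∃ C₂ : ℝ, ∀ (L : Type) [Field L] [NumberField L] [Algebra K L]
        [IsScalarTower ℚ K L] (x r : L),
        r ^ (2 * k + 1) = x * (1 - x) → x ≠ 0 → x ≠ 1 → r ≠ 0 → 1 - 2 * x ≠ 0 →
        ((φ.num * φ.den * (φ.num - φ.den)).map (Int.castRingHom L)).Splits →
        aeval (DeCrit.tC k (algebraMap ℚ L c) x r) (φ.num * φ.den * (φ.num - φ.den)) ≠ 0 →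
        (∀ σ : L →+* ℂ, ∀ a ∈ (resultant (De.curvePoly k) (De.homFibrePolyC k c
          (φ.num.map (Int.castRingHom ℚ) * φ.den.map (Int.castRingHom ℚ) *
            (φ.num.map (Int.castRingHom ℚ) - φ.den.map (Int.castRingHom ℚ))))).aroots ℂ,
          ρ < ‖σ x - a‖) →
        (∀ σ : L →+* PadicAlgCl 2, ∀ a ∈ (resultant (De.curvePoly k) (De.homFibrePolyC k c
          (φ.num.map (Int.castRingHom ℚ) * φ.den.map (Int.castRingHom ℚ) *
            (φ.num.map (Int.castRingHom ℚ) - φ.den.map (Int.castRingHom ℚ))))).aroots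
            (PadicAlgCl 2), ρ < ‖σ x - a‖) →
        (⟨L, DeCrit.tC k (algebraMap ℚ L c) x r⟩ : NFPoint).logCondDiv φ.pullbackCusps ≤
          ((φ.deg + 2 : ℝ) * (2 * k + 4) - (6 * k + 6)) / (2 * k + 1) * (⟨L, x⟩ : NFPoint).ht
            + C₂ := by
  classical
  intro φ hdeg hnum hden hsub _ hAB hcard ρ hρ
  -- the cusp-fibre polynomial `m = f·g·(f−g)` and the bad polynomial `g_bad`
  set mZ : ℤ[X] := φ.num * φ.den * (φ.num - φ.den) with hmZ
  set mQ : ℚ[X] := φ.num.map (Int.castRingHom ℚ) * φ.den.map (Int.castRingHom ℚ) *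
    (φ.num.map (Int.castRingHom ℚ) - φ.den.map (Int.castRingHom ℚ)) with hmQ
  have hmQ_eq : mQ = mZ.map (Int.castRingHom ℚ) := by
    simp only [hmQ, hmZ, Polynomial.map_mul, Polynomial.map_sub]
  have hmZ0 : mZ ≠ 0 := by
    have hinj : Function.Injective (Int.castRingHom ℚ) := (Int.castRingHom ℚ).injective_int
    have hpn : (φ.num.map (Int.castRingHom ℚ)).natDegree = φ.deg := by
      rw [natDegree_map_eq_of_injective hinj, hnum]
    have hqn : (φ.den.map (Int.castRingHom ℚ)).natDegree = φ.deg := by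
      rw [natDegree_map_eq_of_injective hinj, hden]
    have hpqn : (φ.num.map (Int.castRingHom ℚ) - φ.den.map (Int.castRingHom ℚ)).natDegree = φ.deg := by
      rw [← Polynomial.map_sub, natDegree_map_eq_of_injective hinj, hsub]
    have hp0 : φ.num.map (Int.castRingHom ℚ) ≠ 0 := fun h => by rw [h, natDegree_zero] at hpn; omega
    have hq0 : φ.den.map (Int.castRingHom ℚ) ≠ 0 := fun h => by rw [h, natDegree_zero] at hqn; omega
    have hpq0 : φ.num.map (Int.castRingHom ℚ) - φ.den.map (Int.castRingHom ℚ) ≠ 0 := fun h => by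
      rw [h, natDegree_zero] at hpqn; omega
    intro h0
    have : mQ = 0 := by rw [hmQ_eq, h0, Polynomial.map_zero]
    exact mul_ne_zero (mul_ne_zero hp0 hq0) hpq0 this
  have hmQ0 : mQ ≠ 0 := by
    rw [hmQ_eq]; exact (Polynomial.map_ne_zero_iff (Int.castRingHom ℚ).injective_int).mpr hmZ0
  set gbad : ℚ[X] := resultant (De.curvePoly k) (De.homFibrePolyC k c mQ) with hgbad
  -- the fixed field `K`: the parameter, the critical values `A`, the cusp fibre `B_K`
  set cK : K := (c : K) with hcK_def
  have hcK : cK ≠ 0 := by rw [hcK_def]; exact_mod_cast hc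
  have h2K : (2 : K) ≠ 0 := two_ne_zero
  set A : Finset K := (DeCrit.RpolyC k cK).roots.toFinset.image (DeCrit.tCritC k cK) with hA_def
  have hA : ∀ θ : K, (DeCrit.RpolyC k cK).eval θ = 0 → DeCrit.tCritC k cK θ ∈ A := by
    intro θ hθ
    refine Finset.mem_image.mpr ⟨θ, ?_, rfl⟩
    exact Multiset.mem_toFinset.mpr ((mem_roots (DeCrit.RpolyC_ne_zero k cK)).mpr hθ)
  have hcritA : ∀ θ : K, (DeCrit.RpolyC k cK).eval θ = 0 →
      ((1 - 2 * DeCrit.critXC k cK θ) + cK * θ ^ (k + 2)) / (θ * (1 - 2 * DeCrit.critXC k cK θ)) ∈ A := by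
    intro θ hθ
    have e : ((1 - 2 * DeCrit.critXC k cK θ) + cK * θ ^ (k + 2)) / (θ * (1 - 2 * DeCrit.critXC k cK θ))
        = DeCrit.tC k cK (DeCrit.critXC k cK θ) θ := rfl
    rw [e, DeCrit.tC_critPointC h2K]
    exact hA θ hθ
  -- an embedding `τ : K → ℂ` transports `A ⊆ critSetC ⊆ roots(m)` to `K`
  obtain ⟨w₀⟩ := (inferInstance : Nonempty (InfinitePlace K))
  set τ : K →+* ℂ := w₀.embedding with hτ
  have hτc : τ cK = (c : ℂ) := by rw [hcK_def, map_ratCast]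
  have hAm : ∀ θ : K, (DeCrit.RpolyC k cK).eval θ = 0 → aeval (DeCrit.tCritC k cK θ) mZ = 0 := by
    intro θ hθ
    have hθℂ : (DeCrit.RpolyC k (c : ℂ)).eval (τ θ) = 0 := by
      rw [← hτc, DeCrit.eval_RpolyC_map, hθ, map_zero]
    have hmem : τ (DeCrit.tCritC k cK θ) ∈ DeCrit.critSetC k c := by
      rw [DeCrit.mem_critSetC_iff]
      refine ⟨τ θ, hθℂ, ?_⟩
      rw [← DeCrit.tC_critPointC h2K, ← DeCrit.tC_critPointC two_ne_zero, ← hτc]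
      letI : Algebra K ℂ := τ.toAlgebra
      have h := DeC.algebraMap_critValue k (L := ℂ) cK θ
      exact h.symm
    have h := hAB _ hmem
    rw [← map_aeval_intPoly' τ mZ] at h
    exact (map_eq_zero_iff τ τ.injective).mp h
  -- CONSTANTS. (1) the all-defect W5 core (abc-iut-w5-d023 over (F-b) ∘ (S1)): good places, `hconv`,
  -- the defect at EVERY bad prime, summation
  obtain ⟨S, -, hSp, Dp, hcore⟩ := DeC.slope_defect_of_splits k hk (K := K) hcK A hKR hA
  -- (2) J-B: the bad primes of `φ`
  obtain ⟨SJ, hSJp, hJB⟩ := φ.exists_primes_root_ord_sub_pos hnum hden hsub hmZ0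
  set T : Finset ℕ := S ∪ SJ with hT
  have hST : S ⊆ T := Finset.subset_union_left
  have hSJT : SJ ⊆ T := Finset.subset_union_right
  have hTp : ∀ p ∈ T, p.Prime := by
    intro p hp
    rcases Finset.mem_union.mp hp with h | h
    · exact hSp p h
    · exact hSJp p h
  -- (3) archimedean separation
  obtain ⟨C₃, -, harchC⟩ := DeFamily.exists_posLog_infinitePlace_le_of_XphiC_separated k hc hρ
  -- (4) heights of `t_c` and `N_c`
  obtain ⟨C₄, C₅, hheights⟩ := Superelliptic.exists_junction_heights_of_rat k hk c hc
  -- (5) heights of the cusp fibre (field-independent)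
  obtain ⟨C₆, hC₆⟩ := exists_logHeight₁_rootFinset_le mZ hmZ0
  refine ⟨((φ.deg + 2 : ℝ) * C₄ + C₅) / (2 * k + 1) + (φ.deg + 2 : ℝ) * (C₆ + Real.log 2) +
    (∑ p ∈ T, (Dp p : ℝ) * Real.log p) + (∑ p ∈ T, Real.log p) + C₃, ?_⟩
  -- THE POINT
  intro L _ _ _ _ x r hcurve hx0 hx1 hr hs hsplL hOff hfarℂ _
  set cL : L := algebraMap ℚ L c with hcL_def
  have hcL : cL = (c : L) := by rw [hcL_def]; exact eq_ratCast _ c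
  have hιc : algebraMap K L cK = cL := by rw [hcK_def, map_ratCast, hcL]
  have hcL0 : cL ≠ 0 := by rw [hcL]; exact_mod_cast hc
  have h2L : (2 : L) ≠ 0 := two_ne_zero
  have heL : ((2 * k + 1 : ℕ) : L) ≠ 0 := Nat.cast_ne_zero.mpr (by omega)
  set s : L := 1 - 2 * x with hs_def
  set t : L := DeCrit.tC k cL x r with ht_def
  set N : L := -s ^ 3 + algebraMap K L cK * ((k + 1) * r ^ (k + 2) - 2 * r ^ (3 * k + 3)) with hN_def
  have hcurve' : s ^ 2 = 1 - 4 * r ^ (2 * k + 1) := by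
    rw [hs_def]; linear_combination (4 : L) * hcurve
  have hrs : r * s ≠ 0 := mul_ne_zero hr hs
  have ht : t * (r * s) = s + algebraMap K L cK * r ^ (k + 2) := by
    rw [hιc, ht_def, DeCrit.tC, hs_def, div_mul_cancel₀ _ hrs]
  -- the cusp fibre read in `L`
  set B : Finset L := (mZ.map (Int.castRingHom L)).roots.toFinset with hB_def
  have hBroot : ∀ b ∈ B, aeval b mZ = 0 := fun b hb =>
    (mem_roots_map_intCast_iff' hmZ0 _).mp (Multiset.mem_toFinset.mp hb)
  have hAB' : A.map ⟨algebraMap K L, (algebraMap K L).injective⟩ ⊆ B := by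
    intro b hb
    obtain ⟨a, ha, rfl⟩ := Finset.mem_map.mp hb
    obtain ⟨θ, hθ, rfl⟩ := Finset.mem_image.mp ha
    have hθ' : (DeCrit.RpolyC k cK).eval θ = 0 :=
      (mem_roots (DeCrit.RpolyC_ne_zero k cK)).mp (Multiset.mem_toFinset.mp hθ)
    refine Multiset.mem_toFinset.mpr ((mem_roots_map_intCast_iff' hmZ0 _).mpr ?_)
    change aeval (algebraMap K L (DeCrit.tCritC k cK θ)) mZ = 0
    rw [← map_aeval_intPoly' (algebraMap K L) mZ, hAm θ hθ', map_zero]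
  have hBcard : (B.card : ℝ) = φ.deg + 2 := by
    rw [hB_def, card_rootFinset_map_eq_of_splits mZ L hsplL, hcard]; push_cast; ring
  have htB : ∀ b ∈ B, t ≠ b := by
    intro b hb htb
    exact hOff (by rw [htb]; exact hBroot b hb)
  have htA : ∀ a ∈ A, t ≠ algebraMap K L a := fun a ha =>
    htB (algebraMap K L a) (hAB' (Finset.mem_map_of_mem _ ha))
  -- `N ≠ 0`: a zero of `N_c` has `t_c`-value a critical value, hence a root of `m`
  have hN0 : N ≠ 0 := by
    intro hN0
    have hNv : DeCrit.NvalC k cL (x, r) = 0 := by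
      have e : DeCrit.NvalC k cL (x, r) = N := by rw [hN_def, DeCrit.NvalC_eq, hιc, hs_def]
      rw [e, hN0]
    have hcurveP : r ^ (2 * k + 1) = x * (1 - x) := hcurve
    have hx : x = DeCrit.critXC k cL r := DeCrit.fst_eq_critXC_of_NvalC_eq_zero k h2L heL hcL0 hcurveP hNv
    have hR : (DeCrit.RpolyC k cL).eval r = 0 := DeCrit.eval_RpolyC_eq_zero_of_NvalC_eq_zero k cL hcurveP hNv
    obtain ⟨θ₀, hθ₀, hθ₀r⟩ := DeC.exists_root_eq_algebraMap (K := K) k hKR (L := L) (θ := r)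
      (by rw [hιc]; exact hR)
    have htval : t = algebraMap K L (((1 - 2 * DeCrit.critXC k cK θ₀) + cK * θ₀ ^ (k + 2)) /
        (θ₀ * (1 - 2 * DeCrit.critXC k cK θ₀))) := by
      rw [DeC.algebraMap_critValue k (L := L) cK θ₀, hιc, hθ₀r, ← hx, ht_def, DeCrit.tC]
    exact htA _ (hcritA θ₀ hθ₀) htval
  -- the conductor support `W`
  let Qt : NFPoint := ⟨L, t⟩
  have hOff' : Qt.OffDiv φ.pullbackCusps := hOff
  set W : Finset (HeightOneSpectrum (𝓞 L)) := (Qt.condSupportDiv_finite hOff').toFinset with hW_def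
  -- (hW) meeting property off the bad primes of `φ` (J-B)
  have hW : ∀ w ∈ W, w ∉ T.attach.biUnion (fun p => placesOver L p.1) →
      ∃ b ∈ B, 0 < ord L w (t - b) := by
    intro w hw hwT
    have hw' : w ∈ Qt.condSupportDiv φ.pullbackCusps := (Set.Finite.mem_toFinset _).mp hw
    have hwSJ : w ∉ SJ.attach.biUnion (fun p => placesOver L p.1) := by
      intro h
      obtain ⟨p, -, hp⟩ := Finset.mem_biUnion.mp h
      exact hwT (Finset.mem_biUnion.mpr ⟨⟨p.1, hSJT p.2⟩, Finset.mem_attach _ _, hp⟩)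
    have hsplQ : (φ.pullbackCusps.poly.map (Int.castRingHom Qt.F)).Splits := hsplL
    obtain ⟨b, hb, hpos⟩ := hJB Qt hOff' hsplQ w hw' hwSJ
    exact ⟨b, hb, hpos⟩
  -- (harch) archimedean separation
  have harch : ∀ v : InfinitePlace L, Real.posLog (v N⁻¹) ≤ C₃ := by
    intro v
    set Bℂ : Finset ℂ := (mQ.aroots ℂ).toFinset with hBℂ
    have hBℂcrit : DeCrit.critSetC k c ⊆ Bℂ := by
      intro a ha
      refine Multiset.mem_toFinset.mpr (mem_aroots'.mpr ⟨?_, ?_⟩)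
      · exact (Polynomial.map_ne_zero_iff (algebraMap ℚ ℂ).injective).mpr hmQ0
      · rw [hmQ_eq, aeval_map_intCast']; exact hAB a ha
    have hsepv : ∀ a ∈ De.XphiC k (c : ℂ) Bℂ, ρ ≤ ‖v.embedding x - a‖ := by
      intro a ha
      have hroot : a ∈ gbad.rootSet ℂ := by
        rw [hgbad, De.rootSet_resultant_eq_XphiC k hc hmQ0, eq_ratCast]
        exact ha
      have ha' : a ∈ gbad.aroots ℂ := by
        rw [mem_rootSet'] at hroot; exact mem_aroots'.mpr hroot
      exact (hfarℂ v.embedding a ha').le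
    have h := harchC Bℂ hBℂcrit L x r hcurve v hsepv
    have eN : DeFamily.N k (c : L) (x, r) = N := by
      rw [DeFamily.N_eq_mul_sub, hN_def, hιc, hcL, hs_def]; ring
    rw [eN] at h
    rw [map_inv₀]
    exact h
  -- (htH, hNH) heights
  have hN' : N = -s ^ 3 + (c : L) * (((k : L) + 1) * r ^ (k + 2) - 2 * r ^ (3 * k + 3)) := by
    rw [hN_def, hιc, hcL]
  have ht' : t * (r * s) = s + (c : L) * r ^ (k + 2) := by rw [← hcL, ← hιc]; exact ht
  obtain ⟨htH, hNH⟩ := hheights L x r s t N rfl hcurve hx0 hx1 hs ht' hN'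
  -- (hBH) heights of the cusp fibre
  have hBH : ∀ b ∈ B, Height.logHeight₁ b ≤ Module.finrank ℚ L * C₆ := fun b hb => hC₆ L b hb
  -- THE CORE
  have key := hcore L T hST hTp hcurve' ht rfl hr hs hN0 B hAB' htB W
    (C₃ := C₃) (C₄ := C₄) (C₅ := C₅) (C₆ := C₆) hW harch htH hNH hBH
  -- conversion to `logCondDiv` and `ht`
  have hLHS : Qt.logCondDiv φ.pullbackCusps =
      (Module.finrank ℚ L : ℝ)⁻¹ * ∑ w ∈ W, logNorm L w := by
    rw [NFPoint.logCondDiv_eq_sum Qt hOff']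
    rfl
  have hht : (⟨L, x⟩ : NFPoint).ht = (Module.finrank ℚ L : ℝ)⁻¹ * Height.logHeight₁ x := rfl
  change Qt.logCondDiv φ.pullbackCusps ≤ _
  rw [hLHS, hht]
  rw [hBcard] at key
  linarith

end Literature.NumberTheory.DiophantineGeometry.GenEll

end
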